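import Summits.QuantumFields.YangMills.Theorems.BalabanUVNodesN08AtRecord13CoPHLaneFamily
import Summits.QuantumFields.YangMills.Theorems.BalabanUVNodesN08AlphaEq324RowCumLetterEnd

/-!
# BalabanUVNodes ∕ N08 AT THE LANE-RE-BOUND v1.7 STAGE-13 RECORD (`IsRecordOfRecord₁₃CCoPH`) FROM THE RANGE-HONEST CORE (α) CLAUSE AT AN ARBITRARY CUMULANT LETTER
# (`…N08AlphaEq324RowCumLetter.RunAlphaEq324CoreLTAt 𝔄 c`, `𝔄 : AlphaDataLT`) — the record-level twins of `…N08AtRecord13CoPHLaneProfile` §3's `_of_runAlpha` closers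

Cell `pub-ymgap`, seat `pub-ymgap-dag-n08-w4` gen 2 (INTENT-6; sequel of `…RowCumLetterEnd` p598497 ✓).  `bears_on: R4∕N08`; filed `--supports stmt-QuantumFields-20542` (K1⁷).
THEOREMS ONLY (def-free, sorry-free, standard axioms); dag-n08-c g17's `…N08AtRecord13CoPHLaneFamily` GENERIC closers (`exists_world₁₃CCoPH_rebindX_towerRuns_b10_main`,
`exists_guarded_record₁₃CCoPH_b10_main_of_towerRuns`) and gen 0's abstracted `…N08ConstructedCoreLT.b10Compact_constructedLE_of_concreteLeaves` consumed BY NAME; nothing of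
the `…CoPHLane*` files is edited or re-declared.

WHY.  `…N08AtRecord13CoPHLaneProfile` §3 (`exists_world₁₃CCoPH_laneFamily_b10_main_of_runAlpha` ∕ `exists_guarded_record₁₃CCoPH_…_of_runAlpha`) reads the lane's ORIGINAL clause
`UVStability3DInputs.RunAlpha 𝔊 𝔠 (X S) (𝔖 S) (𝔄 S)` over the bundle `𝔄 S : AlphaData` — which is EMPTY for records with `r₀ = 2`, `Cfar·C63 > 0` (gen 0's located 13C ∕
`…RowRangeZero.isEmpty_alphaData_and_nonempty_alphaDataLT`), so those record-level closers are vacuous there; and it fixes the (3.24)∕G3D-02 rows at the lane's χ-weighted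
cumulant letter.  Here the SAME record-level conclusions are derived from `RunAlphaEq324CoreLTAt 𝔊 𝔠 (X S) (𝔖 S) (𝔄 S) (c S)` with `𝔄 S : AlphaDataLT` (inhabitable for every
record, gen 0 `…RowRangeZero` ∕ gen 2 `…RowCumLetterZero`) at ANY letter `c` (e.g. the free moment-cumulants of the [2]-road):
* §1 `b10Compact_constructedLE_of_coreLTAt_at` — the compact node of the constructed runs on ANY window `ScalesLE L ((min γ 1)²)`, `0 ≤ γ ≤ γ₀`, from the re-lettered clause
  on that window; `b10Compact_laneFamily_of_coreLTAt` — at the N08 window `γ_N08` and the record's carriers `θ.res.X P`.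
* §2 ★ `exists_world₁₃CCoPH_laneFamily_b10_main_of_coreLTAt` (pointed: a ₁₃CCoPH record of `datumOfRecord₁₃CoPH F N θ h` bound over the lane-re-bound H view, any
  window `γw`, carrying N08 at every run) and ★ `exists_guarded_record₁₃CCoPH_laneFamily_b10_main_of_coreLTAt` (N08's conjunct shape of a C-keyed `NodesAtSomeRecord13`,
  AT `θ`) — `…LaneProfile` §3 with `RunAlpha ↦ RunAlphaEq324CoreLTAt … (c S)`.
HONEST FRAMING — as in `…CoPHLaneFamily` ∕ `…CoPHLaneProfile`: the re-bound [B10] layer is THE LANE'S constructed family, NOT print's run family of record (`pinB10`), hence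
NOT the slot `Node00.PrintedUV3V N θ.L`; whether N08's COUNT may be read there is the chair's species word.  A re-key with a non-vacuous bundle, not progress on the object
gap: the rows of the clause ARE the cluster expansion (class II), displayed as hypotheses; the IDENT of B10's step measures with a class model untouched; N08 NOT
discharged; count-neutral; K0 ∕ K1 neither proved nor assumed; one finite four-torus per run at fixed `ε`, the lane's d = 3 tori inside the record; nothing continuum ∕
ℝ⁴ ∕ OS ∕ mass gap ∕ Clay — R4 closes the conditional finite-𝕋⁴ rung `BalabanLadder.UV` only.
-/

noncomputable section

namespace Summit.QuantumFields.YangMills.BalabanUVNodes.N08AtRecord13CoPHLaneCumLetter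

open MeasureTheory
open scoped BigOperators Matrix.Norms.L2Operator
open Literature.MathematicalPhysics.QuantumFieldTheory.Balaban1983to89
open Literature.MathematicalPhysics.QuantumFieldTheory.Balaban1983to89.B10
open Literature.MathematicalPhysics.QuantumFieldTheory.Balaban1985CMP102
open Literature.MathematicalPhysics.QuantumFieldTheory.Balaban1985CMP102.Setting
open Literature.MathematicalPhysics.QuantumFieldTheory.Balaban1985CMP102.Theorems (Family runs)
open Literature.MathematicalPhysics.QuantumFieldTheory.Balaban1983to89.T4Continuum (T4Family FiniteEpsData)
open Literature.MathematicalPhysics.QuantumFieldTheory.Balaban1983to89.DagBinding (leavesP WorldP PrintedCarriersR PrintedCarriers9X PrintedCarriers11 PrintedCarriers15)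
open Literature.MathematicalPhysics.QuantumFieldTheory.Balaban1983to89.DagDischarged (b10Compact)
open Literature.MathematicalPhysics.QuantumFieldTheory.Balaban1983to89.Node00
open Summit.QuantumFields.Balaban3D.Carriers
open Summit.QuantumFields.Balaban3D.Proofs.Inputs
open Summit.QuantumFields.Balaban3D.Proofs.Primitives (AlphaConsts)
open Summit.QuantumFields.Balaban3D.Proofs.GroupModelLieC (lieC)
open Summit.QuantumFields.Balaban3D.Proofs.UVStability3DInputs
open Summit.QuantumFields.Balaban3D.Proofs.FamilyLE (ScalesLE)
open Summit.QuantumFields.YangMills.Theorems.BalabanUVNodesN08AlphaThreeFaces (gammaN08 gammaN08_pos gammaN08_le_gamma0 sq_min_one_mono)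
open Summit.QuantumFields.YangMills.Theorems.BalabanUVNodesN08AlphaEq324RowRange (AlphaDataLT)
open Summit.QuantumFields.YangMills.Theorems.BalabanUVNodesN08AlphaEq324RowCumLetter (RunAlphaEq324CoreLTAt)
open Summit.QuantumFields.YangMills.Theorems.BalabanUVNodesN08AlphaEq324RowCumLetterEnd (nonempty_concreteLeaves_of_coreLTAt_le)
open Summit.QuantumFields.YangMills.Theorems.BalabanUVNodesN08ConstructedCoreLT (b10Compact_constructedLE_of_concreteLeaves)
open Summit.QuantumFields.YangMills.BalabanUVNodes.N08AtRecord13CoPH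
open Summit.QuantumFields.YangMills.BalabanUVNodes.N08AtRecord13CoPHLaneFamily

variable {F : T4Family} {N : ℕ} [NeZero N]

/-! ## §1 The compact node of the constructed runs on a window, from the re-lettered clause -/

section Compact
variable {L : ℕ} {G : Type} [GaugeGroup G] [MeasurableSpace G] [HaarData G] {𝔊 : GroupModel G} {𝔠 : AlphaConsts L 𝔊.N}
  {X : ∀ S : Scales L, ExternalInputs S G} {𝔖 : ∀ (S : Scales L) (k : ℕ), StepSeries S G ↥(lieC 𝔊) (nblkOf S 𝔠.lane.carrier k) k}
  {𝔄 : ∀ S : Scales L, AlphaDataLT 𝔊 𝔠 (X S) (𝔖 S)} {c : ∀ (S : Scales L) (k : ℕ), Hist S.P (k + 1) → GaugeField S.P (k + 1) G → ℕ → ℝ}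

/-- **THE COMPACT NODE OF THE CONSTRUCTED RUNS ON ANY WINDOW `ScalesLE L ((min γ 1)²)`, `0 ≤ γ ≤ γ₀`, FROM THE RE-LETTERED CORE (α) CLAUSE on that window** (gen 0's
abstracted closer fed with `…RowCumLetterEnd.nonempty_concreteLeaves_of_coreLTAt_le`; the window sits inside the `γ₀`-window by `sq_min_one_mono`).
[cite: Balaban1985UV3, Thm 1 p.257 (compact reading) + Thm 2 p.272] -/
theorem b10Compact_constructedLE_of_coreLTAt_at {γ : ℝ} (hγ0 : 0 ≤ γ) (hγ : γ ≤ 𝔠.gamma0)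
    (hα : ∀ S : Scales L, S.g ^ 2 * S.ε₀ ≤ (min γ 1) ^ 2 → RunAlphaEq324CoreLTAt 𝔊 𝔠 (X S) (𝔖 S) (𝔄 S) (c S)) (Xc : PrintedCarriersR) :
    b10Compact (Xc.withTowerRuns10 fun S : ScalesLE L ((min γ 1) ^ 2) => towerOf 𝔠.lane (X S.1) (𝔖 S.1)).toPrintedCarriers :=
  b10Compact_constructedLE_of_concreteLeaves
    (fun S => nonempty_concreteLeaves_of_coreLTAt_le S.1 (S.2.trans (sq_min_one_mono hγ0 hγ)) (hα S.1 S.2)) Xc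

end Compact

section Lane
variable {G : Type} [GaugeGroup G] [MeasurableSpace G] [HaarData G] {𝔊 : GroupModel G}

/-- **The compact node of the lane family on the N08 window `γ_N08` at the record's carriers `θ.res.X P`, from the re-lettered clause** (`…LaneProfile.b10Compact_laneFamily_of_runAlpha`
with `RunAlpha ↦ RunAlphaEq324CoreLTAt`). [cite: Balaban1985UV3, Thm 1 p.257 (compact reading) + Thm 2 p.272] -/
theorem b10Compact_laneFamily_of_coreLTAt (θ : Stage13Params F N) {𝔠 : AlphaConsts θ.L 𝔊.N} {X : ∀ S : Scales θ.L, ExternalInputs S G}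
    {𝔖 : ∀ (S : Scales θ.L) (k : ℕ), StepSeries S G ↥(lieC 𝔊) (nblkOf S 𝔠.lane.carrier k) k} {𝔄 : ∀ S : Scales θ.L, AlphaDataLT 𝔊 𝔠 (X S) (𝔖 S)}
    {c : ∀ (S : Scales θ.L) (k : ℕ), Hist S.P (k + 1) → GaugeField S.P (k + 1) G → ℕ → ℝ}
    (hα : ∀ S : Scales θ.L, S.g ^ 2 * S.ε₀ ≤ (min (gammaN08 𝔠) 1) ^ 2 → RunAlphaEq324CoreLTAt 𝔊 𝔠 (X S) (𝔖 S) (𝔄 S) (c S)) (P : B12.RunParams) :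
    b10Compact ((θ.res.X P).withTowerRuns10 fun S : ScalesLE θ.L ((min (gammaN08 𝔠) 1) ^ 2) => towerOf 𝔠.lane (X S.1) (𝔖 S.1)).toPrintedCarriers :=
  b10Compact_constructedLE_of_coreLTAt_at (gammaN08_pos 𝔠).le (gammaN08_le_gamma0 𝔠) hα (θ.res.X P)

/-! ## §2 N08 at the lane-re-bound ₁₃CCoPH record from the re-lettered clause -/

/-- ★ **POINTED: a ₁₃CCoPH record of `datumOfRecord₁₃CoPH F N θ h` bound over the lane-re-bound Stage-13 view, carrying N08 at every run, from the re-lettered range-honest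
core (α) clause on the N08 window** (any window `γw`, block size `θ.L`; bundle `AlphaDataLT`, any cumulant letter `c`) — `…LaneProfile.exists_world₁₃CCoPH_laneFamily_b10_main_of_runAlpha`
with `RunAlpha ↦ RunAlphaEq324CoreLTAt`. [cite: Balaban1985UV3, Thm 1 p.257 (compact reading) + Thm 2 p.272; Balaban1989LargeFieldII, Thm 1 + (0.1) pp.355–356 (bookkeeping)] -/
theorem exists_world₁₃CCoPH_laneFamily_b10_main_of_coreLTAt {θ : Stage13HParams F N} (h : θ.Provisos₁₃CoPH F N) (hθ : θ.Admissible F N)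
    {𝔠 : AlphaConsts θ.L 𝔊.N} {X : ∀ S : Scales θ.L, ExternalInputs S G}
    {𝔖 : ∀ (S : Scales θ.L) (k : ℕ), StepSeries S G ↥(lieC 𝔊) (nblkOf S 𝔠.lane.carrier k) k} {𝔄 : ∀ S : Scales θ.L, AlphaDataLT 𝔊 𝔠 (X S) (𝔖 S)}
    {c : ∀ (S : Scales θ.L) (k : ℕ), Hist S.P (k + 1) → GaugeField S.P (k + 1) G → ℕ → ℝ}
    (hα : ∀ S : Scales θ.L, S.g ^ 2 * S.ε₀ ≤ (min (gammaN08 𝔠) 1) ^ 2 → RunAlphaEq324CoreLTAt 𝔊 𝔠 (X S) (𝔖 S) (𝔄 S) (c S)) {γw : ℝ} (hγw : 0 < γw ∧ γw ≤ θ.γ) :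
    ∃ w : WorldP, IsRecordOfRecord₁₃CCoPH F N (datumOfRecord₁₃CoPH F N θ h) w ∧ w.γ = γw ∧ w.L = (θ.L : ℝ) ∧
      (∀ P, w.up P = upOfRecord₅C F N ((θ.rebindX F N fun P => (θ.res.X P).withTowerRuns10
        fun S : ScalesLE θ.L ((min (gammaN08 𝔠) 1) ^ 2) => towerOf 𝔠.lane (X S.1) (𝔖 S.1)).toStage5₁₃CoPH F N) P) ∧
      ∀ P : B12.RunParams, Dag.B10_main (leavesP w P) :=
  exists_world₁₃CCoPH_rebindX_towerRuns_b10_main _ _ h hθ hγw (b10Compact_laneFamily_of_coreLTAt θ.toStage13Params hα)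

/-- ★ **N08's conjunct shape of `NodesAtSomeRecord13`, witnessed AT `θ`, from the re-lettered range-honest core (α) clause on the N08 window** (plus provisos, admissibility,
guard) — `…LaneProfile.exists_guarded_record₁₃CCoPH_laneFamily_b10_main_of_runAlpha` with `RunAlpha ↦ RunAlphaEq324CoreLTAt`.
[cite: Balaban1985UV3, Thm 1 p.257 (compact reading) + Thm 2 p.272; Balaban1989LargeFieldII, Thm 1 + (0.1) pp.355–356; Balaban1988Convergent, (3.16)–(3.22) pp.268–269 (bookkeeping)] -/
theorem exists_guarded_record₁₃CCoPH_laneFamily_b10_main_of_coreLTAt {θ : Stage13HParams F N} (h : θ.Provisos₁₃CoPH F N) (hθ : θ.Admissible F N)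
    (hG : θ.ZhUnity F N ∧ θ.SlotsNondegenerate₁₃ F N) {𝔠 : AlphaConsts θ.L 𝔊.N} {X : ∀ S : Scales θ.L, ExternalInputs S G}
    {𝔖 : ∀ (S : Scales θ.L) (k : ℕ), StepSeries S G ↥(lieC 𝔊) (nblkOf S 𝔠.lane.carrier k) k} {𝔄 : ∀ S : Scales θ.L, AlphaDataLT 𝔊 𝔠 (X S) (𝔖 S)}
    {c : ∀ (S : Scales θ.L) (k : ℕ), Hist S.P (k + 1) → GaugeField S.P (k + 1) G → ℕ → ℝ}
    (hα : ∀ S : Scales θ.L, S.g ^ 2 * S.ε₀ ≤ (min (gammaN08 𝔠) 1) ^ 2 → RunAlphaEq324CoreLTAt 𝔊 𝔠 (X S) (𝔖 S) (𝔄 S) (c S)) :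
    ∃ (θ' : Stage13HParams F N) (h' : θ'.Provisos₁₃CoPH F N) (w : WorldP), (θ'.ZhUnity F N ∧ θ'.SlotsNondegenerate₁₃ F N) ∧ θ'.Admissible F N ∧
      IsRecordOfRecord₁₃CCoPH F N (datumOfRecord₁₃CoPH F N θ' h') w ∧ ∀ P : B12.RunParams, Dag.B10_main (leavesP w P) :=
  exists_guarded_record₁₃CCoPH_b10_main_of_towerRuns _ _ h hθ hG (b10Compact_laneFamily_of_coreLTAt θ.toStage13Params hα)

end Lane

end Summit.QuantumFields.YangMills.BalabanUVNodes.N08AtRecord13CoPHLaneCumLetter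

end
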